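import Literature.Barriers.Parity.SiegelZeroDichotomyPairHLProp71Y
import Literature.Barriers.Parity.SiegelZeroDichotomyPairHLProp71Poisson
import Literature.NumberTheory.Sieve.SieveFrameworkProofs
import HarnessLib

/-!
# Tao–Teräväinen 2022, Proposition 7.1: the main term `X`

Topic `Literature/Barriers/Parity`, sub-namespace `TaoTeravainen`; a file of the proof DAG of
`Literature.Barriers.Parity.TaoTeravainen2021_prop72_81_pair` (T. Tao, J. Teräväinen, *The
Hardy–Littlewood–Chowla conjecture in the presence of a Siegel zero*, J. London Math. Soc. (2) 106
(2022), arXiv:2109.06291), proof of Proposition 7.1 (i), the quantity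
`X := ∑_{n₁,n₂ : n₁n₂ ∈ 𝒜} χ(n₁) Φ̃_t(n₂) ψ_I(n₁n₂)` of the modified Fourier expansion (Lemma 3.9):
"By Möbius inversion one can write `1_𝒜(n) = ∑_{d ∣ q} c_d 1_{n = a mod q₁}` … For those `q₁` with
`q₁ > D^{1/2} q_χ² x^{-4ε}` we simply use the triangle inequality … Now suppose instead that
`q₁ ≤ D^{1/2} q_χ² x^{-4ε}` … [two Fourier expansions] … We thus have `X ≪_A x^{-A}`."
Everything here is PROVED, in explicit form (`G(n₁,n₂) = Φ̃_t(n₂) ψ_I(n₁n₂)` is `hypWeight`):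

* `mainTermX` (`X`, with `1_𝒜(N) = 1_{N ≡ r (q₀')} 1_{(N,Q) = g'}` as provided by
  `modifiedFourierExpansion`) and `mainTermXe` (the same with `1_{(N,Q)=g'}` replaced by
  `1_{g'e ∣ N}`); `mainTermX_eq_sum_moebius` — the Möbius inversion
  `X = ∑_{e ∣ Q/g'} μ(e) X_e`;
* `abs_mainTermXe_le_trivial` — the triangle-inequality bound
  `|X_e| ≤ sup|φ'| C_δ B^δ (B/[q₀', g'e] + 2)` (divisor bound);
* `abs_mainTermXe_le_poisson` — the Poisson bound
  `|X_e| ≤ (π²/3)(2π)^{-m} (B-A) (I_m(φ) L^m e^{-vm} + sup|φ'| K_m (L e^{v+1}/Δ)^m)`, `L = [q₀', g'e]`,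
  valid when `q ∣ L`, `e^{v+1} ≤ min(M, 2A)`, `B ≤ M`.
  [cite: TaoTeravainen2021, proof of Proposition 7.1 (the estimate for X)]
-/

noncomputable section

open Finset Real MeasureTheory
open scoped ContDiff

namespace Literature.Barriers.Parity

namespace TaoTeravainen

open Literature.Analysis.Calculus

open ArithmeticFunction (moebius)
open Literature.NumberTheory.Sieve (sum_divisors_moebius_real)

variable {q : ℕ}

/-! ### The objects -/

/-- `X = ∑_{n₁,n₂ ≤ M} χ(n₁) G(n₁,n₂) 1_{n₁n₂ ≡ r (q₀')} 1_{(n₁n₂, Q) = g'}`.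
[cite: TaoTeravainen2021, proof of Proposition 7.1 (the quantity X)] -/
def mainTermX (χ : DirichletCharacter ℂ q) (φ : ℝ → ℝ) (A B Δ v : ℝ) (M q₀' Q g' r : ℕ) : ℝ :=
  ∑ n₁ ∈ Icc 1 M, ∑ n₂ ∈ Icc 1 M, realChar χ n₁ * hypWeight φ A B Δ v n₁ n₂ *
    (if n₁ * n₂ ≡ r [MOD q₀'] ∧ Nat.gcd (n₁ * n₂) Q = g' then 1 else 0)

/-- `X_e = ∑_{n₁,n₂ ≤ M} χ(n₁) G(n₁,n₂) 1_{n₁n₂ ≡ r (q₀')} 1_{E ∣ n₁n₂}` (`E = g'e`).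
[cite: TaoTeravainen2021, proof of Proposition 7.1 ("`1_𝒜(n) = ∑_{d∣q} c_d 1_{n = a mod q₁}`")] -/
def mainTermXe (χ : DirichletCharacter ℂ q) (φ : ℝ → ℝ) (A B Δ v : ℝ) (M q₀' E r : ℕ) : ℝ :=
  ∑ n₁ ∈ Icc 1 M, ∑ n₂ ∈ Icc 1 M, realChar χ n₁ * hypWeight φ A B Δ v n₁ n₂ *
    (if n₁ * n₂ ≡ r [MOD q₀'] ∧ E ∣ n₁ * n₂ then 1 else 0)

/-! ### Möbius inversion of the gcd condition -/

/-- `∑_{e ∣ K, e ∣ N} μ(e) = 1_{(N, K) = 1}` for `K ≠ 0`. [folklore] -/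
theorem sum_divisors_moebius_filter_dvd {K : ℕ} (hK : K ≠ 0) (N : ℕ) :
    ∑ e ∈ K.divisors, (if e ∣ N then (moebius e : ℝ) else 0) =
      if Nat.gcd N K = 1 then 1 else 0 := by
  rw [← sum_filter]
  have hset : K.divisors.filter (fun e => e ∣ N) = (Nat.gcd N K).divisors := by
    ext e
    simp only [mem_filter, Nat.mem_divisors, Nat.dvd_gcd_iff, ne_eq, Nat.gcd_eq_zero_iff, not_and]
    constructor
    · rintro ⟨⟨h1, _⟩, h2⟩; exact ⟨⟨h2, h1⟩, fun _ => hK⟩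
    · rintro ⟨⟨h2, h1⟩, _⟩; exact ⟨⟨h1, hK⟩, h2⟩
  rw [hset, sum_divisors_moebius_real]

/-- The pointwise Möbius identity:
`1_{N ≡ r (q₀')} 1_{(N,Q) = g'} = ∑_{e ∣ Q/g'} μ(e) 1_{N ≡ r (q₀')} 1_{g'e ∣ N}` when `g' ∣ Q`,
`g' ∣ q₀'`, `g' ∣ r`, `Q ≠ 0`. [folklore] -/
theorem indicator_gcd_eq_sum_moebius {Q g' q₀' r : ℕ} (hQ : Q ≠ 0) (hg'Q : g' ∣ Q)
    (hg'q : g' ∣ q₀') (hg'r : g' ∣ r) (N : ℕ) :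
    (if N ≡ r [MOD q₀'] ∧ Nat.gcd N Q = g' then (1 : ℝ) else 0) =
      ∑ e ∈ (Q / g').divisors, (moebius e : ℝ) *
        (if N ≡ r [MOD q₀'] ∧ g' * e ∣ N then 1 else 0) := by
  have hg'0 : g' ≠ 0 := fun h => hQ (Nat.eq_zero_of_zero_dvd (h ▸ hg'Q))
  have hg'pos : 0 < g' := Nat.pos_of_ne_zero hg'0
  have hQg : Q / g' ≠ 0 := (Nat.div_pos (Nat.le_of_dvd (Nat.pos_of_ne_zero hQ) hg'Q) hg'pos).ne'
  by_cases hN : N ≡ r [MOD q₀']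
  · have hg'N : g' ∣ N := ((hN.of_dvd hg'q).dvd_iff dvd_rfl).mpr hg'r
    simp only [hN, true_and]
    have h1 : ∀ e : ℕ, (g' * e ∣ N ↔ e ∣ N / g') := fun e => by
      rw [Nat.dvd_div_iff_mul_dvd hg'N, mul_comm]
    simp_rw [h1, mul_ite, mul_one, mul_zero]
    rw [sum_divisors_moebius_filter_dvd hQg (N / g')]
    have hgd : g' ∣ Nat.gcd N Q := Nat.dvd_gcd hg'N hg'Q
    have hiff : Nat.gcd (N / g') (Q / g') = 1 ↔ Nat.gcd N Q = g' := by
      rw [Nat.gcd_div hg'N hg'Q]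
      constructor
      · intro h
        have := Nat.div_mul_cancel hgd
        rw [h, one_mul] at this
        exact this.symm
      · intro h; rw [h, Nat.div_self hg'pos]
    by_cases hc : Nat.gcd N Q = g'
    · rw [if_pos hc, if_pos (hiff.mpr hc)]
    · rw [if_neg hc, if_neg (mt hiff.mp hc)]
  · simp only [hN, false_and, ↓reduceIte, mul_zero, sum_const_zero]

/-- **Möbius inversion**: `X = ∑_{e ∣ Q/g'} μ(e) X_e` (for `g' ∣ Q`, `g' ∣ q₀'`, `g' ∣ r`).
[cite: TaoTeravainen2021, proof of Proposition 7.1 ("By Möbius inversion one can write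
`1_𝒜(n) = ∑_{d ∣ q} c_d 1_{n = a mod q₁}` for some coefficients `c_d = O(1)`")] -/
theorem mainTermX_eq_sum_moebius (χ : DirichletCharacter ℂ q) (φ : ℝ → ℝ) (A B Δ v : ℝ) (M : ℕ)
    {Q g' q₀' r : ℕ} (hQ : Q ≠ 0) (hg'Q : g' ∣ Q) (hg'q : g' ∣ q₀') (hg'r : g' ∣ r) :
    mainTermX χ φ A B Δ v M q₀' Q g' r =
      ∑ e ∈ (Q / g').divisors, (moebius e : ℝ) * mainTermXe χ φ A B Δ v M q₀' (g' * e) r := by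
  unfold mainTermX mainTermXe
  simp_rw [indicator_gcd_eq_sum_moebius hQ hg'Q hg'q hg'r, mul_sum]
  symm
  rw [sum_comm]
  refine sum_congr rfl fun n₁ _ => ?_
  rw [sum_comm]
  refine sum_congr rfl fun n₂ _ => ?_
  refine sum_congr rfl fun e _ => ?_
  ring

/-! ### Counting tools -/

/-- Hyperbola-to-divisor reindexing: for `f ≥ 0`,
`∑_{n₁,n₂ ∈ [1,M]} f(n₁n₂) ≤ ∑_{N ∈ [1,M²]} τ(N) f(N)`. [folklore] -/
theorem sum_sum_mul_le_sum_card_divisors {f : ℕ → ℝ} (hf : ∀ N, 0 ≤ f N) (M : ℕ) :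
    ∑ n₁ ∈ Icc 1 M, ∑ n₂ ∈ Icc 1 M, f (n₁ * n₂) ≤
      ∑ N ∈ Icc 1 (M * M), (N.divisors.card : ℝ) * f N := by
  rw [← sum_product']
  have hmaps : ∀ p ∈ Icc 1 M ×ˢ Icc 1 M, p.1 * p.2 ∈ Icc 1 (M * M) := by
    intro p hp
    rw [mem_product, mem_Icc, mem_Icc] at hp
    rw [mem_Icc]
    exact ⟨Nat.one_le_iff_ne_zero.mpr (Nat.mul_ne_zero (by omega) (by omega)),
      Nat.mul_le_mul hp.1.2 hp.2.2⟩
  rw [← sum_fiberwise_of_maps_to hmaps]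
  refine sum_le_sum fun N hN => ?_
  have hN0 : N ≠ 0 := by rw [mem_Icc] at hN; omega
  calc ∑ p ∈ (Icc 1 M ×ˢ Icc 1 M).filter (fun p => p.1 * p.2 = N), f (p.1 * p.2)
      = ∑ p ∈ (Icc 1 M ×ˢ Icc 1 M).filter (fun p => p.1 * p.2 = N), f N :=
        sum_congr rfl fun p hp => by rw [(mem_filter.mp hp).2]
    _ = (((Icc 1 M ×ˢ Icc 1 M).filter (fun p => p.1 * p.2 = N)).card : ℝ) * f N := by
        rw [sum_const, nsmul_eq_mul]
    _ ≤ (N.divisors.card : ℝ) * f N := by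
        refine mul_le_mul_of_nonneg_right ?_ (hf N)
        have hsub : (Icc 1 M ×ˢ Icc 1 M).filter (fun p => p.1 * p.2 = N) ⊆ N.divisorsAntidiagonal := by
          intro p hp
          rw [mem_filter] at hp
          rw [Nat.mem_divisorsAntidiagonal]
          exact ⟨hp.2, hN0⟩
        have := card_le_card hsub
        rw [← Nat.map_div_right_divisors, card_map] at this
        exact_mod_cast this

/-- Integers below `K` in one residue class modulo `L` number at most `K/L + 1`. [folklore] -/
theorem card_filter_range_mod_le (L K c : ℕ) :
    ((range K).filter (fun N => N % L = c)).card ≤ K / L + 1 := by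
  have hmaps : Set.MapsTo (fun N => N / L) (((range K).filter (fun N => N % L = c)) : Set ℕ)
      ((range (K / L + 1)) : Set ℕ) := by
    intro N hN
    rw [coe_filter, Set.mem_setOf_eq, mem_range] at hN
    rw [coe_range, Set.mem_Iio]
    exact Nat.lt_succ_of_le (Nat.div_le_div_right hN.1.le)
  have hinj : Set.InjOn (fun N => N / L) (((range K).filter (fun N => N % L = c)) : Set ℕ) := by
    intro N hN N' hN' h
    rw [coe_filter, Set.mem_setOf_eq] at hN hN'
    have e1 := Nat.div_add_mod N L
    have e2 := Nat.div_add_mod N' L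
    simp only at h
    rw [← e1, ← e2, h, hN.2, hN'.2]
  have := card_le_card_of_injOn _ hmaps hinj
  rwa [card_range] at this

/-- Two congruence conditions `N ≡ r (q₀')`, `E ∣ N` confine `N` to one class modulo
`[q₀', E]`: all solutions are congruent to each other. [folklore] -/
theorem modEq_lcm_of_conds {q₀' E r N N' : ℕ} (hN : N ≡ r [MOD q₀'] ∧ E ∣ N)
    (hN' : N' ≡ r [MOD q₀'] ∧ E ∣ N') : N ≡ N' [MOD Nat.lcm q₀' E] := by
  have h1 : N ≡ N' [MOD q₀'] := hN.1.trans hN'.1.symm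
  have h2 : N ≡ N' [MOD E] :=
    (Nat.modEq_zero_iff_dvd.mpr hN.2).trans (Nat.modEq_zero_iff_dvd.mpr hN'.2).symm
  exact Nat.mod_lcm h1 h2

/-- The number of `N < K` with `N ≡ r (q₀')`, `E ∣ N` is at most `K/[q₀',E] + 1`. [folklore] -/
theorem card_filter_conds_le (q₀' E r K : ℕ) :
    (((range K).filter (fun N => N ≡ r [MOD q₀'] ∧ E ∣ N)).card : ℝ) ≤
      (K : ℝ) / Nat.lcm q₀' E + 1 := by
  set L := Nat.lcm q₀' E with hLdef
  by_cases hempty : ((range K).filter (fun N => N ≡ r [MOD q₀'] ∧ E ∣ N)) = ∅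
  · rw [hempty, card_empty, Nat.cast_zero]; positivity
  · obtain ⟨N₀, hN₀⟩ := nonempty_iff_ne_empty.mpr hempty
    rw [mem_filter] at hN₀
    have hsub : (range K).filter (fun N => N ≡ r [MOD q₀'] ∧ E ∣ N) ⊆
        (range K).filter (fun N => N % L = N₀ % L) := by
      intro N hN
      rw [mem_filter] at hN ⊢
      exact ⟨hN.1, modEq_lcm_of_conds hN.2 hN₀.2⟩
    calc ((((range K).filter (fun N => N ≡ r [MOD q₀'] ∧ E ∣ N)).card : ℕ) : ℝ)
        ≤ (((range K).filter (fun N => N % L = N₀ % L)).card : ℝ) := by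
          exact_mod_cast card_le_card hsub
      _ ≤ ((K / L + 1 : ℕ) : ℝ) := by exact_mod_cast card_filter_range_mod_le L K _
      _ ≤ (K : ℝ) / L + 1 := by
          push_cast
          gcongr
          exact Nat.cast_div_le

/-! ### The trivial bound -/

/-- **The triangle-inequality bound for `X_e`**: with `|φ'| ≤ B₁`, `0 ≤ A`, `0 ≤ B`, `Δ > 0` and
a divisor bound `τ(n) ≤ C_δ n^δ`,
`|X_e| ≤ B₁ C_δ B^δ (B/[q₀', E] + 2)` ("we simply use the triangle inequality, (2.16) and crude
estimates to obtain `X ≪ x^{1+ε²}/q₁`"). [cite: TaoTeravainen2021, proof of Proposition 7.1 (the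
estimate for X, large `q₁`)] -/
theorem abs_mainTermXe_le_trivial (χ : DirichletCharacter ℂ q) {φ : ℝ → ℝ} {B₁ : ℝ}
    (hB₁ : ∀ u, |deriv φ u| ≤ B₁) {A B Δ : ℝ} (hB : 0 ≤ B) (hΔ : 0 < Δ) (v : ℝ)
    (M : ℕ) {q₀' E : ℕ} (hq : 0 < q₀') (hE : 0 < E) (r : ℕ) {δ Cδ : ℝ} (hδ : 0 < δ) (hC0 : 0 ≤ Cδ)
    (hCδ : ∀ n : ℕ, n ≠ 0 → (n.divisors.card : ℝ) ≤ Cδ * (n : ℝ) ^ δ) :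
    |mainTermXe χ φ A B Δ v M q₀' E r| ≤ B₁ * (Cδ * B ^ δ) * (B / Nat.lcm q₀' E + 2) := by
  have hB₁0 : 0 ≤ B₁ := (abs_nonneg _).trans (hB₁ 0)
  -- the indicator that survives
  set J : ℕ → ℝ := fun N => if (N : ℝ) < B ∧ (N ≡ r [MOD q₀'] ∧ E ∣ N) then 1 else 0 with hJ
  have hJ0 : ∀ N, 0 ≤ J N := fun N => by simp only [hJ]; positivity
  have hterm : ∀ n₁ n₂ : ℕ, |realChar χ n₁ * hypWeight φ A B Δ v n₁ n₂ *
      (if n₁ * n₂ ≡ r [MOD q₀'] ∧ E ∣ n₁ * n₂ then 1 else 0)| ≤ B₁ * J (n₁ * n₂) := by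
    intro n₁ n₂
    simp only [hJ]
    by_cases hcond : n₁ * n₂ ≡ r [MOD q₀'] ∧ E ∣ n₁ * n₂
    · rw [if_pos hcond]
      by_cases hlt : ((n₁ * n₂ : ℕ) : ℝ) < B
      · rw [if_pos ⟨hlt, hcond⟩, mul_one, mul_one, abs_mul]
        calc |realChar χ n₁| * |hypWeight φ A B Δ v n₁ n₂| ≤ 1 * B₁ :=
              mul_le_mul (abs_realChar_le_one χ _) (abs_hypWeight_le hB₁ A B Δ v n₁ n₂)
                (abs_nonneg _) zero_le_one
          _ = B₁ := one_mul _
      · -- `n₁ n₂ ≥ B`: the cutoff vanishes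
        have hz : hypWeight φ A B Δ v n₁ n₂ = 0 := by
          unfold hypWeight
          rw [plateauProfile_eq_zero_of_ge hΔ (not_lt.mp hlt), mul_zero]
        rw [hz, mul_zero, zero_mul, abs_zero]
        positivity
    · rw [if_neg hcond, mul_zero, abs_zero]
      positivity
  calc |mainTermXe χ φ A B Δ v M q₀' E r|
      ≤ ∑ n₁ ∈ Icc 1 M, ∑ n₂ ∈ Icc 1 M, B₁ * J (n₁ * n₂) := by
        unfold mainTermXe
        refine (abs_sum_le_sum_abs _ _).trans (sum_le_sum fun n₁ _ => ?_)
        exact (abs_sum_le_sum_abs _ _).trans (sum_le_sum fun n₂ _ => hterm n₁ n₂)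
    _ = B₁ * ∑ n₁ ∈ Icc 1 M, ∑ n₂ ∈ Icc 1 M, J (n₁ * n₂) := by
        rw [mul_sum]; refine sum_congr rfl fun _ _ => ?_; rw [mul_sum]
    _ ≤ B₁ * ∑ N ∈ Icc 1 (M * M), (N.divisors.card : ℝ) * J N :=
        mul_le_mul_of_nonneg_left (sum_sum_mul_le_sum_card_divisors hJ0 M) hB₁0
    _ ≤ B₁ * ∑ N ∈ Icc 1 (M * M), (Cδ * B ^ δ) * J N := by
        refine mul_le_mul_of_nonneg_left (sum_le_sum fun N hN => ?_) hB₁0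
        -- `τ(N) J(N) ≤ C_δ B^δ J(N)`: only `N < B` matters
        simp only [hJ]
        split_ifs with h
        · rw [mul_one, mul_one]
          have hN0 : N ≠ 0 := by rw [mem_Icc] at hN; omega
          calc (N.divisors.card : ℝ) ≤ Cδ * (N : ℝ) ^ δ := hCδ N hN0
            _ ≤ Cδ * B ^ δ := by
                gcongr
                exact h.1.le
        · rw [mul_zero, mul_zero]
    _ = B₁ * (Cδ * B ^ δ) * ∑ N ∈ Icc 1 (M * M), J N := by rw [← mul_sum]; ring
    _ ≤ B₁ * (Cδ * B ^ δ) * (B / Nat.lcm q₀' E + 2) := by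
        refine mul_le_mul_of_nonneg_left ?_ (by positivity)
        -- `∑ J ≤ #{N < ⌈B⌉ : conds} ≤ ⌈B⌉/L + 1 ≤ B/L + 2`
        have hle : ∑ N ∈ Icc 1 (M * M), J N ≤
            (((range ⌈B⌉₊).filter (fun N => N ≡ r [MOD q₀'] ∧ E ∣ N)).card : ℝ) := by
          rw [card_eq_sum_ones, Nat.cast_sum, sum_filter]
          push_cast
          -- compare termwise on `range ⌈B⌉ ∪ Icc 1 (M*M)` via nonnegativity
          have h1 : ∑ N ∈ Icc 1 (M * M), J N = ∑ N ∈ (Icc 1 (M * M)).filter (fun N => N < ⌈B⌉₊), J N := by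
            rw [sum_filter]
            refine sum_congr rfl fun N _ => ?_
            simp only [hJ]
            by_cases h : N < ⌈B⌉₊
            · rw [if_pos h]
            · rw [if_neg h, if_neg]
              rintro ⟨hlt, -⟩
              exact h (Nat.lt_ceil.mpr hlt)
          rw [h1]
          refine (sum_le_sum_of_subset_of_nonneg (t := range ⌈B⌉₊) (fun N hN => ?_)
            (fun N _ _ => hJ0 N)).trans (sum_le_sum fun N _ => ?_)
          · rw [mem_filter] at hN; exact mem_range.mpr hN.2
          · simp only [hJ]
            split_ifs with h1 h2 h2
            · exact le_rfl
            · exact absurd h1.2 h2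
            · exact zero_le_one
            · exact le_rfl
        refine hle.trans ((card_filter_conds_le q₀' E r ⌈B⌉₊).trans ?_)
        have hceil : (⌈B⌉₊ : ℝ) ≤ B + 1 := (Nat.ceil_lt_add_one hB).le
        have hL1 : (1 : ℝ) ≤ Nat.lcm q₀' E := by exact_mod_cast Nat.lcm_pos hq hE
        have hLpos : (0 : ℝ) < Nat.lcm q₀' E := by linarith
        calc (⌈B⌉₊ : ℝ) / Nat.lcm q₀' E + 1 ≤ (B + 1) / Nat.lcm q₀' E + 1 := by gcongr
          _ = B / Nat.lcm q₀' E + (1 / Nat.lcm q₀' E + 1) := by ring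
          _ ≤ B / Nat.lcm q₀' E + 2 := by
              have : 1 / (Nat.lcm q₀' E : ℝ) ≤ 1 := by
                rw [div_le_one hLpos]; exact hL1
              linarith

/-! ### The Poisson bound -/

/-- `χ` (as `realChar`) is `q`-periodic. [folklore] -/
theorem realChar_congr (χ : DirichletCharacter ℂ q) {n n' : ℕ} (h : n ≡ n' [MOD q]) :
    realChar χ n = realChar χ n' := by
  unfold realChar
  rw [(ZMod.natCast_eq_natCast_iff _ _ _).mpr h]

/-- The congruence indicator `κ₀(N) = 1_{N ≡ r (q₀')} 1_{E ∣ N}`. [folklore] -/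
def condInd (q₀' E r N : ℕ) : ℝ := if N ≡ r [MOD q₀'] ∧ E ∣ N then 1 else 0

/-- `κ₀` depends only on `N mod [q₀', E]`. [folklore] -/
theorem condInd_congr {q₀' E r N N' : ℕ} (h : N ≡ N' [MOD Nat.lcm q₀' E]) :
    condInd q₀' E r N = condInd q₀' E r N' := by
  unfold condInd
  have h1 : N ≡ N' [MOD q₀'] := h.of_dvd (Nat.dvd_lcm_left _ _)
  have h2 : N ≡ N' [MOD E] := h.of_dvd (Nat.dvd_lcm_right _ _)
  have e1 : (N ≡ r [MOD q₀']) ↔ (N' ≡ r [MOD q₀']) := ⟨fun h => h1.symm.trans h, fun h => h1.trans h⟩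
  have e2 : (E ∣ N) ↔ (E ∣ N') := h2.dvd_iff dvd_rfl
  simp only [e1, e2]

/-- `|κ₀| ≤ 1`, indeed `0 ≤ κ₀ ≤ 1`. [folklore] -/
theorem abs_condInd_le (q₀' E r N : ℕ) : |condInd q₀' E r N| ≤ 1 := by
  unfold condInd; split_ifs <;> simp

/-- `0 ≤ ∫ ψ_I ≤ B - A` for `A ≤ B`, `Δ > 0`. [folklore] -/
theorem integral_plateauProfile_le {A B Δ : ℝ} (hΔ : 0 < Δ) (hAB : A ≤ B) :
    0 ≤ ∫ y, plateauProfile A B Δ y ∧ ∫ y, plateauProfile A B Δ y ≤ B - A := by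
  refine ⟨integral_nonneg fun y => plateauProfile_nonneg A B Δ y, ?_⟩
  have hzero : ∀ y ∉ Set.Icc A B, plateauProfile A B Δ y = 0 := by
    intro y hy
    rw [Set.mem_Icc, not_and_or, not_le, not_le] at hy
    rcases hy with hy | hy
    · exact plateauProfile_eq_zero_of_le hΔ hy.le
    · exact plateauProfile_eq_zero_of_ge hΔ hy.le
  rw [← setIntegral_eq_integral_of_forall_compl_eq_zero (s := Set.Icc A B) (fun y hy => hzero y hy)]
  have h := norm_setIntegral_le_of_norm_le_const (s := Set.Icc A B) (f := plateauProfile A B Δ)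
    (C := 1) (μ := volume) (by rw [Real.volume_Icc]; exact ENNReal.ofReal_lt_top)
    (fun y _ => by rw [Real.norm_eq_abs]; exact abs_plateauProfile_le_one A B Δ y)
  rw [Real.volume_real_Icc_of_le hAB, one_mul, Real.norm_eq_abs] at h
  exact (le_abs_self _).trans h

/-- The residue-class filter in `ℕ`- and `ℤ`-form. [folklore] -/
theorem filter_mod_eq_filter_zmod (S : Finset ℕ) {L c : ℕ} (hc : c < L) :
    S.filter (fun n => n % L = c) = S.filter (fun n : ℕ => (n : ℤ) ≡ (c : ℤ) [ZMOD (L : ℤ)]) := by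
  refine filter_congr fun n _ => ?_
  rw [Int.natCast_modEq_iff, Nat.ModEq, Nat.mod_eq_of_lt hc]

/-- **The Poisson bound for `X_e`**: with `L = [q₀', E]`, `q ∣ L`, `m ≥ 2`, `v ≥ 2`,
`e^{v+1} ≤ min(M, 2A)`, `A ≤ B ≤ M`, `Δ > 0`:
`|X_e| ≤ (π²/3)(2π)^{-m} (B - A) (I_m(φ) L^m e^{-vm} + sup|φ'| K_m (L e^{v+1}/Δ)^m)`
("`∑_{n₁} ψ_I(n₁n₂) e_{q₁}(u n₁n₂) = (1_{n₂u=0 (q₁)}/n₂)∫ψ_I + O_A(x^{-A})` … `∑_n Φ̃_t(n)/n e_{q₁}(-run) … is `O_A(x^{-A})` … We thus have `X ≪_A x^{-A}`").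
[cite: TaoTeravainen2021, proof of Proposition 7.1 (the estimate for X, small `q₁`)] -/
theorem abs_mainTermXe_le_poisson (χ : DirichletCharacter ℂ q) {φ : ℝ → ℝ} (hφ : IsBump φ)
    {B₁ : ℝ} (hB₁ : ∀ u, |deriv φ u| ≤ B₁) {A B Δ v : ℝ} (hΔ : 0 < Δ) (hAB : A ≤ B) (hv : 2 ≤ v)
    {M : ℕ} (hvM : Real.exp (v + 1) ≤ M) (hvA : Real.exp (v + 1) ≤ 2 * A) (hBM : B ≤ M)
    {q₀' E : ℕ} (hq₀ : 0 < q₀') (hE : 0 < E) (hqL : q ∣ Nat.lcm q₀' E) (r : ℕ) {m : ℕ}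
    (hm : 2 ≤ m) :
    |mainTermXe χ φ A B Δ v M q₀' E r| ≤
      (π ^ 2 / 3) / (2 * π) ^ m * (B - A) *
        (logBumpNorm φ m * (Nat.lcm q₀' E : ℝ) ^ m * Real.exp (-v) ^ m +
          B₁ * plateauDerivConst m * ((Nat.lcm q₀' E : ℝ) * Real.exp (v + 1) / Δ) ^ m) := by
  set L : ℕ := Nat.lcm q₀' E with hLdef
  have hL : 0 < L := Nat.lcm_pos hq₀ hE
  have hLr : (0 : ℝ) < L := by exact_mod_cast hL
  have hB₁0 : 0 ≤ B₁ := (abs_nonneg _).trans (hB₁ 0)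
  set C₁ : ℝ := (π ^ 2 / 3) / (2 * π) ^ m with hC₁
  have hC₁0 : 0 ≤ C₁ := by positivity
  set MI : ℝ := ∫ y, plateauProfile A B Δ y with hMI
  obtain ⟨hMI0, hMIle⟩ := integral_plateauProfile_le (A := A) (B := B) hΔ hAB
  set a : ℕ → ℝ := hypDerivWeight φ v with ha
  set ψ : ℝ → ℝ := plateauProfile A B Δ with hψ
  set κ : ℕ → ℝ := condInd q₀' E r with hκ
  set T : ℝ := Real.exp (v + 1) with hT
  have hTpos : 0 < T := Real.exp_pos _
  -- the class sums
  set P : ℕ → ℕ → ℝ := fun c n₂ => ∑ n₁ ∈ (Icc 1 M).filter (fun n => n % L = c), ψ ((n₁ * n₂ : ℕ) : ℝ)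
    with hP
  set R : ℕ → ℝ := fun d => ∑ n₂ ∈ (Icc 1 M).filter (fun n => n % L = d), a n₂ / n₂ with hR
  -- Step 1: `X_e = ∑_{n₂} a(n₂) ∑_c χ(c) κ(c n₂) P(c, n₂)`
  have hmaps : ∀ n ∈ Icc 1 M, n % L ∈ range L := fun n _ => mem_range.mpr (Nat.mod_lt _ hL)
  have hstep1 : mainTermXe χ φ A B Δ v M q₀' E r =
      ∑ n₂ ∈ Icc 1 M, a n₂ * ∑ c ∈ range L, realChar χ c * κ (c * n₂) * P c n₂ := by
    unfold mainTermXe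
    rw [sum_comm]
    refine sum_congr rfl fun n₂ _ => ?_
    -- partition `n₁` by its class mod `L`
    rw [← sum_fiberwise_of_maps_to hmaps]
    rw [mul_sum]
    refine sum_congr rfl fun c hc => ?_
    rw [hP]
    simp only
    rw [mul_sum, mul_sum]
    refine sum_congr rfl fun n₁ hn₁ => ?_
    rw [mem_filter] at hn₁
    have hmod : n₁ ≡ c [MOD L] := by rw [Nat.ModEq, hn₁.2, Nat.mod_eq_of_lt (mem_range.mp hc)]
    have hχ : realChar χ n₁ = realChar χ c := realChar_congr χ (hmod.of_dvd hqL)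
    have hκ' : κ (n₁ * n₂) = κ (c * n₂) := condInd_congr (hmod.mul_right n₂)
    unfold hypWeight
    rw [hχ, show (if n₁ * n₂ ≡ r [MOD q₀'] ∧ E ∣ n₁ * n₂ then (1 : ℝ) else 0) = κ (n₁ * n₂) from rfl,
      hκ']
    ring
  -- Step 2: the Poisson estimate for `P`
  have hPerr : ∀ c ∈ range L, ∀ n₂ ∈ Icc 1 M, (n₂ : ℝ) ≤ T →
      |P c n₂ - MI / (L * n₂)| ≤
        C₁ * (L : ℝ) ^ (m - 1) * ((n₂ : ℝ) ^ (m - 1) * (plateauDerivConst m / Δ ^ m) * (B - A)) := by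
    intro c hc n₂ hn₂ hn₂T
    rw [mem_range] at hc
    rw [mem_Icc] at hn₂
    have h := norm_sum_filter_plateauProfile_sub_le (A := A) (B := B) hΔ hAB hn₂.1
      (hn₂T.trans hvA) hL (c : ℤ) hm hBM
    rw [← filter_mod_eq_filter_zmod _ hc] at h
    have hcast : (∑ n₁ ∈ (Icc 1 M).filter (fun n => n % L = c),
        ((plateauProfile A B Δ ((n₁ * n₂ : ℕ) : ℝ) : ℝ) : ℂ)) -
        (((∫ y, plateauProfile A B Δ y) / (L * n₂) : ℝ) : ℂ) = ((P c n₂ - MI / (L * n₂) : ℝ) : ℂ) := by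
      rw [hP]; push_cast; rfl
    rw [hcast, Complex.norm_real, Real.norm_eq_abs] at h
    exact h
  -- Step 3: the Poisson estimate for `R`
  have hRerr : ∀ d ∈ range L, |R d| ≤ C₁ * (L : ℝ) ^ (m - 1) * (Real.exp (-v) ^ m * logBumpNorm φ m) := by
    intro d hd
    rw [mem_range] at hd
    have h := norm_sum_filter_logBumpDeriv_le hφ (by linarith : (1 : ℝ) ≤ v) hL (d : ℤ) hm hvM
    rw [← filter_mod_eq_filter_zmod _ hd] at h
    have hcast : ∑ n ∈ (Icc 1 M).filter (fun n => n % L = d),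
        ((deriv φ (Real.log n - v) / n : ℝ) : ℂ) = ((R d : ℝ) : ℂ) := by
      rw [hR]; push_cast
      refine sum_congr rfl fun n hn => ?_
      rw [mem_filter, mem_Icc] at hn
      rw [ha]
      unfold hypDerivWeight
      rw [if_neg (by omega)]
    rw [hcast, Complex.norm_real, Real.norm_eq_abs] at h
    exact h
  -- Step 4: split `P = MI/(L n₂) + (P - MI/(L n₂))`
  have hsplit : mainTermXe χ φ A B Δ v M q₀' E r =
      MI / L * ∑ c ∈ range L, realChar χ c * ∑ n₂ ∈ Icc 1 M, κ (c * n₂) * (a n₂ / n₂) +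
        ∑ n₂ ∈ Icc 1 M, a n₂ * ∑ c ∈ range L, realChar χ c * κ (c * n₂) * (P c n₂ - MI / (L * n₂)) := by
    rw [hstep1]
    have : ∀ n₂ ∈ Icc 1 M, a n₂ * ∑ c ∈ range L, realChar χ c * κ (c * n₂) * P c n₂ =
        MI / L * ∑ c ∈ range L, realChar χ c * (κ (c * n₂) * (a n₂ / n₂)) +
          a n₂ * ∑ c ∈ range L, realChar χ c * κ (c * n₂) * (P c n₂ - MI / (L * n₂)) := by
      intro n₂ hn₂
      rw [mem_Icc] at hn₂
      have hn0 : (n₂ : ℝ) ≠ 0 := by exact_mod_cast (by omega : n₂ ≠ 0)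
      rw [mul_sum, mul_sum, mul_sum, ← sum_add_distrib]
      refine sum_congr rfl fun c _ => ?_
      field_simp
      ring
    rw [sum_congr rfl this, sum_add_distrib, ← mul_sum]
    congr 1
    rw [sum_comm]
    simp_rw [mul_sum]
  -- Step 5: the main part, via `R`
  have hmain : |MI / L * ∑ c ∈ range L, realChar χ c * ∑ n₂ ∈ Icc 1 M, κ (c * n₂) * (a n₂ / n₂)| ≤
      (B - A) * (C₁ * (L : ℝ) ^ m * (Real.exp (-v) ^ m * logBumpNorm φ m)) := by
    -- each inner sum splits over classes of `n₂`
    have hinner : ∀ c ∈ range L, |∑ n₂ ∈ Icc 1 M, κ (c * n₂) * (a n₂ / n₂)| ≤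
        (L : ℝ) * (C₁ * (L : ℝ) ^ (m - 1) * (Real.exp (-v) ^ m * logBumpNorm φ m)) := by
      intro c _
      rw [← sum_fiberwise_of_maps_to hmaps]
      have hclass : ∀ d ∈ range L, ∑ n₂ ∈ (Icc 1 M).filter (fun n => n % L = d), κ (c * n₂) * (a n₂ / n₂) =
          κ (c * d) * R d := by
        intro d hd
        rw [hR]; simp only; rw [mul_sum]
        refine sum_congr rfl fun n₂ hn₂ => ?_
        rw [mem_filter] at hn₂
        have hmod : n₂ ≡ d [MOD L] := by rw [Nat.ModEq, hn₂.2, Nat.mod_eq_of_lt (mem_range.mp hd)]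
        have hκ' : κ (c * n₂) = κ (c * d) := condInd_congr (hmod.mul_left c)
        rw [hκ']
      rw [sum_congr rfl hclass]
      calc |∑ d ∈ range L, κ (c * d) * R d| ≤ ∑ d ∈ range L, |κ (c * d) * R d| := abs_sum_le_sum_abs _ _
        _ ≤ ∑ d ∈ range L, C₁ * (L : ℝ) ^ (m - 1) * (Real.exp (-v) ^ m * logBumpNorm φ m) := by
            refine sum_le_sum fun d hd => ?_
            rw [abs_mul]
            calc |κ (c * d)| * |R d| ≤ 1 * (C₁ * (L : ℝ) ^ (m - 1) * (Real.exp (-v) ^ m * logBumpNorm φ m)) :=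
                  mul_le_mul (abs_condInd_le _ _ _ _) (hRerr d hd) (abs_nonneg _) zero_le_one
              _ = _ := one_mul _
        _ = (L : ℝ) * (C₁ * (L : ℝ) ^ (m - 1) * (Real.exp (-v) ^ m * logBumpNorm φ m)) := by
            rw [sum_const, card_range, nsmul_eq_mul]
    rw [abs_mul, abs_div, abs_of_nonneg hMI0, abs_of_pos hLr]
    calc MI / L * |∑ c ∈ range L, realChar χ c * ∑ n₂ ∈ Icc 1 M, κ (c * n₂) * (a n₂ / n₂)|
        ≤ MI / L * ((L : ℝ) * ((L : ℝ) * (C₁ * (L : ℝ) ^ (m - 1) * (Real.exp (-v) ^ m * logBumpNorm φ m)))) := by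
          refine mul_le_mul_of_nonneg_left ?_ (by positivity)
          calc |∑ c ∈ range L, realChar χ c * ∑ n₂ ∈ Icc 1 M, κ (c * n₂) * (a n₂ / n₂)|
              ≤ ∑ c ∈ range L, |realChar χ c * ∑ n₂ ∈ Icc 1 M, κ (c * n₂) * (a n₂ / n₂)| :=
                abs_sum_le_sum_abs _ _
            _ ≤ ∑ c ∈ range L, (L : ℝ) * (C₁ * (L : ℝ) ^ (m - 1) * (Real.exp (-v) ^ m * logBumpNorm φ m)) := by
                refine sum_le_sum fun c hc => ?_
                rw [abs_mul]
                calc |realChar χ c| * |∑ n₂ ∈ Icc 1 M, κ (c * n₂) * (a n₂ / n₂)|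
                    ≤ 1 * ((L : ℝ) * (C₁ * (L : ℝ) ^ (m - 1) * (Real.exp (-v) ^ m * logBumpNorm φ m))) :=
                      mul_le_mul (abs_realChar_le_one χ _) (hinner c hc) (abs_nonneg _) zero_le_one
                  _ = _ := one_mul _
            _ = _ := by rw [sum_const, card_range, nsmul_eq_mul]
      _ = MI * (C₁ * ((L : ℝ) * (L : ℝ) ^ (m - 1)) * (Real.exp (-v) ^ m * logBumpNorm φ m)) := by
          field_simp
      _ = MI * (C₁ * (L : ℝ) ^ m * (Real.exp (-v) ^ m * logBumpNorm φ m)) := by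
          rw [← pow_succ', Nat.sub_add_cancel (by omega : 1 ≤ m)]
      _ ≤ (B - A) * (C₁ * (L : ℝ) ^ m * (Real.exp (-v) ^ m * logBumpNorm φ m)) := by
          refine mul_le_mul_of_nonneg_right hMIle ?_
          have : 0 ≤ logBumpNorm φ m := integral_nonneg fun y => norm_nonneg _
          positivity
  -- Step 6: the error part
  have herr : |∑ n₂ ∈ Icc 1 M, a n₂ * ∑ c ∈ range L, realChar χ c * κ (c * n₂) * (P c n₂ - MI / (L * n₂))| ≤
      T * (B₁ * ((L : ℝ) * (C₁ * (L : ℝ) ^ (m - 1) *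
        (T ^ (m - 1) * (plateauDerivConst m / Δ ^ m) * (B - A))))) := by
    set W : ℝ := B₁ * ((L : ℝ) * (C₁ * (L : ℝ) ^ (m - 1) *
        (T ^ (m - 1) * (plateauDerivConst m / Δ ^ m) * (B - A)))) with hW
    have hW0 : 0 ≤ W := by
      have := plateauDerivConst_nonneg m
      have : 0 ≤ B - A := by linarith
      positivity
    -- termwise: zero unless `n₂ ≤ T`, and then `≤ W`
    have hterm : ∀ n₂ ∈ Icc 1 M,
        |a n₂ * ∑ c ∈ range L, realChar χ c * κ (c * n₂) * (P c n₂ - MI / (L * n₂))| ≤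
          if n₂ ≤ ⌊T⌋₊ then W else 0 := by
      intro n₂ hn₂
      have hn₂' := hn₂
      rw [mem_Icc] at hn₂'
      split_ifs with hle
      · have hn₂T : (n₂ : ℝ) ≤ T := by
          have := Nat.floor_le hTpos.le
          exact le_trans (by exact_mod_cast hle) this
        rw [abs_mul]
        calc |a n₂| * |∑ c ∈ range L, realChar χ c * κ (c * n₂) * (P c n₂ - MI / (L * n₂))|
            ≤ B₁ * ((L : ℝ) * (C₁ * (L : ℝ) ^ (m - 1) *
                ((n₂ : ℝ) ^ (m - 1) * (plateauDerivConst m / Δ ^ m) * (B - A)))) := by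
              refine mul_le_mul (abs_hypDerivWeight_le hB₁ v n₂) ?_ (abs_nonneg _) hB₁0
              calc |∑ c ∈ range L, realChar χ c * κ (c * n₂) * (P c n₂ - MI / (L * n₂))|
                  ≤ ∑ c ∈ range L, |realChar χ c * κ (c * n₂) * (P c n₂ - MI / (L * n₂))| :=
                    abs_sum_le_sum_abs _ _
                _ ≤ ∑ c ∈ range L, C₁ * (L : ℝ) ^ (m - 1) *
                    ((n₂ : ℝ) ^ (m - 1) * (plateauDerivConst m / Δ ^ m) * (B - A)) := by
                    refine sum_le_sum fun c hc => ?_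
                    rw [abs_mul, abs_mul]
                    calc |realChar χ c| * |κ (c * n₂)| * |P c n₂ - MI / (L * n₂)|
                        ≤ 1 * 1 * (C₁ * (L : ℝ) ^ (m - 1) *
                            ((n₂ : ℝ) ^ (m - 1) * (plateauDerivConst m / Δ ^ m) * (B - A))) := by
                          refine mul_le_mul (mul_le_mul (abs_realChar_le_one χ _) (abs_condInd_le _ _ _ _)
                            (abs_nonneg _) zero_le_one) (hPerr c hc n₂ hn₂ hn₂T) (abs_nonneg _)
                            (by norm_num)
                      _ = _ := by ring
                _ = _ := by rw [sum_const, card_range, nsmul_eq_mul]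
          _ ≤ W := by
              rw [hW]
              have := plateauDerivConst_nonneg m
              have : 0 ≤ B - A := by linarith
              gcongr
      · -- `n₂ > T`: `a(n₂) = 0`
        have hgt : T < n₂ := by
          have := Nat.lt_floor_add_one T
          push Not at hle
          calc T < (⌊T⌋₊ : ℝ) + 1 := this
            _ ≤ n₂ := by exact_mod_cast hle
        have : a n₂ = 0 := hypDerivWeight_eq_zero hφ (Or.inr hgt)
        rw [this, zero_mul, abs_zero]
    calc |∑ n₂ ∈ Icc 1 M, a n₂ * ∑ c ∈ range L, realChar χ c * κ (c * n₂) * (P c n₂ - MI / (L * n₂))|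
        ≤ ∑ n₂ ∈ Icc 1 M, |a n₂ * ∑ c ∈ range L, realChar χ c * κ (c * n₂) * (P c n₂ - MI / (L * n₂))| :=
          abs_sum_le_sum_abs _ _
      _ ≤ ∑ n₂ ∈ Icc 1 M, (if n₂ ≤ ⌊T⌋₊ then W else 0) := sum_le_sum hterm
      _ = (((Icc 1 M).filter (fun n₂ => n₂ ≤ ⌊T⌋₊)).card : ℝ) * W := by
          rw [← sum_filter, sum_const, nsmul_eq_mul]
      _ ≤ (⌊T⌋₊ : ℝ) * W := by
          refine mul_le_mul_of_nonneg_right ?_ hW0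
          have : (Icc 1 M).filter (fun n₂ => n₂ ≤ ⌊T⌋₊) ⊆ Icc 1 ⌊T⌋₊ := by
            intro n hn
            rw [mem_filter, mem_Icc] at hn
            rw [mem_Icc]; exact ⟨hn.1.1, hn.2⟩
          have h := card_le_card this
          rw [Nat.card_Icc, add_tsub_cancel_right] at h
          exact_mod_cast h
      _ ≤ T * W := mul_le_mul_of_nonneg_right (Nat.floor_le hTpos.le) hW0
  -- Step 7: combine
  rw [hsplit]
  refine (abs_add_le _ _).trans ?_
  refine (add_le_add hmain herr).trans (le_of_eq ?_)
  have hLm : (L : ℝ) * (L : ℝ) ^ (m - 1) = (L : ℝ) ^ m := by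
    rw [← pow_succ', Nat.sub_add_cancel (by omega : 1 ≤ m)]
  have hTm : T * T ^ (m - 1) = T ^ m := by
    rw [← pow_succ', Nat.sub_add_cancel (by omega : 1 ≤ m)]
  rw [div_pow, mul_pow, ← hLm, ← hTm]
  ring


end TaoTeravainen

end Literature.Barriers.Parity
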